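import Literature.Computability.Cryptography.VanDamSeroussiKernelMass
import Literature.NumberTheory.GaussSums.KummerSector
import Mathlib.NumberTheory.MulChar.Lemmas
import HarnessLib

/-!
# The cubic Gauss sum through the repeated dyadic register (van Dam–Seroussi, analysis II)

Topic `Literature/Computability/Cryptography`; sequel of `VanDamSeroussiReplicatedFourier.lean` and
`VanDamSeroussiKernelMass.lean`, third analysis file towards the discharge of
`VanDamSeroussi2002_cubicGaussSumPhase_qsolvable`. We specialise the
coefficient vector to the cubic residue character `χ = χ_{p,r}` (`Literature.NumberTheory.GaussSums.cubicChar`)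
and prove the identity behind van Dam–Seroussi's Algorithm 1 (§4: "the expression between the big
parentheses equals `G(𝔽_p, χ, βy)`, which equals `χ(y⁻¹) G(𝔽_p, χ, β)` for `y ≠ 0` and is zero if `y = 0`")
in the repeated dyadic picture:

* `chiN p r x = χ(x mod p)` as a coefficient vector on `ℕ`, its values (`‖χ‖ ≤ 1`,
  `χ · conj χ = [p ∤ x]`, `Σ_{x<p} ‖χ x‖ ≤ p`, values in `{0, 1, ω, ω²}`) and **`zpFourier_chiN`**:
  `φ̂(k) = Σ_{x<p} χ(x) e(xk/p) = conj(χ(k)) · G` for every `k : ℕ` (Mathlib's `gaussSum_mulShift_eq`;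
  `Σ χ = 0` at `k ≡ 0`);
* **`cubic_main`**: with the weight `d = χ(k_y)` (the tree's replacement for the phase change
  `|y⟩ ↦ χ²(y)|y⟩` of Algorithm 1, here read against the reference of flat spectrum),
  `|Σ_{y<N} conj(S y) χ(k_y) repFourier χ y − G · goodWeight| ≤ π N √L p`, so that the argument of the
  left sum is that of `G` up to a relative error `O(p^{3/2}/√L)`;
* **`sum_omega_pow_coset_eq`**: the same sum split along the three cosets of cubes on both sides,
  `Σ_{c,c'<3} ω^{c+c'} U_{c,c'}` with `U_{c,c'} = Σ_{y : χ(k_y)=ω^c} conj(S y) · repFourier 𝟙_{χ=ω^{c'}} y` —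
  the nine numbers that the exact Clifford+`T` experiments of the sequel files estimate.

Everything is proved; no named fact is introduced.

## References

* W. van Dam, G. Seroussi, arXiv:quant-ph/0207131 (2002), §2.1 Fact 1, §4 Algorithm 1 (proof) and Thm. 1
  [VanDamSeroussi2002].
* K. Ireland, M. Rosen, *A Classical Introduction to Modern Number Theory*, GTM 84, Prop. 8.2.2,
  Ch. 9 §3 [IrelandRosen1990].
* L. Hales, S. Hallgren, FOCS 2000 [HalesHallgren2000].
-/

noncomputable section

namespace Literature.Computability.Cryptography

namespace VanDamSeroussi

open Finset Complex
open Literature.Computability.QuantumComplexity.QFTQubits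
open Literature.NumberTheory.GaussSums

variable (N L p r : ℕ)

/-! ### The cubic character as a coefficient vector on `ℕ` -/

/-- `chiN p r x = χ_{p,r}(x mod p)`: the cubic residue character read on natural numbers. [folklore] -/
def chiN (x : ℕ) : ℂ := cubicChar p r (x : ZMod p)

/-- `‖ω‖ = 1`. [folklore] -/
theorem norm_omega : ‖omega‖ = 1 := omega_isPrimitiveRoot.norm'_eq_one three_ne_zero

/-- `ω ≠ 0`. [folklore] -/
theorem omega_ne_zero : omega ≠ 0 := fun h => by simpa [h] using norm_omega

/-- `ω² ≠ 1`. [folklore] -/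
theorem omega_sq_ne_one : omega ^ 2 ≠ 1 :=
  omega_isPrimitiveRoot.pow_ne_one_of_pos_of_lt (by norm_num) (by norm_num)

/-- `ω ≠ ω²`. [folklore] -/
theorem omega_ne_omega_sq : omega ≠ omega ^ 2 := fun h => by
  have := omega_isPrimitiveRoot.pow_inj (by norm_num : 1 < 3) (by norm_num : 2 < 3) (by rw [pow_one]; exact h)
  norm_num at this

variable {p r} in
/-- The values of `χ` lie in `{0, 1, ω, ω²}`. [folklore] -/
theorem chiN_cases (x : ℕ) :
    chiN p r x = 0 ∨ chiN p r x = 1 ∨ chiN p r x = omega ∨ chiN p r x = omega ^ 2 := by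
  unfold chiN cubicChar
  split_ifs <;> simp

variable {p r} in
/-- The values of `χ` have modulus `≤ 1`. [folklore] -/
theorem norm_chiN_le (x : ℕ) : ‖chiN p r x‖ ≤ 1 := by
  rcases chiN_cases (p := p) (r := r) x with h | h | h | h <;> simp [h, norm_omega]

variable {p r} in
/-- `χ(x) · conj χ(x) = [p ∤ x]` (in `ℂ`). [folklore] -/
theorem chiN_mul_conj (x : ℕ) :
    chiN p r x * (starRingEnd ℂ) (chiN p r x) = if p ∣ x then 0 else 1 := by
  have hval : ∀ z : ℂ, ‖z‖ = 1 → z * (starRingEnd ℂ) z = 1 := fun z hz => by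
    rw [Complex.mul_conj', hz]; simp
  unfold chiN cubicChar
  by_cases h0 : (x : ZMod p) = 0
  · rw [if_pos h0, if_pos ((ZMod.natCast_eq_zero_iff x p).1 h0)]; simp
  · rw [if_neg h0, if_neg (fun h => h0 ((ZMod.natCast_eq_zero_iff x p).2 h))]
    split_ifs
    · exact hval _ (by simp)
    · exact hval _ norm_omega
    · exact hval _ (by simp [norm_omega])

variable {p r} in
/-- `Σ_{x<p} ‖χ x‖ ≤ p`. [folklore] -/
theorem sum_norm_chiN_le : ∑ x ∈ range p, ‖chiN p r x‖ ≤ p := by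
  calc ∑ x ∈ range p, ‖chiN p r x‖ ≤ ∑ x ∈ range p, (1 : ℝ) := sum_le_sum fun x _ => norm_chiN_le x
    _ = p := by simp

/-- **van Dam–Seroussi's Fact 1 / Algorithm 1 for the cubic character**: the `ℤ/p`-Fourier coefficient of
`χ` at every natural frequency `k` is `conj(χ(k)) · G`, `G = g(χ_{p,r})` the cubic Gauss sum (both sides
vanish at `k ≡ 0`). [cite: VanDamSeroussi2002, §2.1 Fact 1 and §4 Algorithm 1 (proof)] -/
theorem zpFourier_chiN (hp : p.Prime) (h3 : p % 3 = 1) (hr : IsPrimitiveRoot (r : ZMod p) (p - 1))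
    (k : ℕ) : zpFourier p (chiN p r) k = (starRingEnd ℂ) (chiN p r k) * cubicGaussSum p r := by
  haveI := Fact.mk hp
  -- the shifted additive character on natural numbers
  have hchar : ∀ a : ℕ, (ZMod.stdAddChar ((k : ZMod p) * (a : ZMod p)) : ℂ) = eR ((a : ℝ) * k / p) := by
    intro a
    rw [← Nat.cast_mul, ZMod.stdAddChar_apply, ZMod.toCircle_natCast]
    unfold eR; apply congrArg; push_cast; ring
  -- rewrite the range sum as a Gauss sum over `ZMod p` with the shifted additive character
  have hsum : zpFourier p (chiN p r) k =
      gaussSum (cubicMulChar h3 hr) ((ZMod.stdAddChar (N := p)).mulShift (k : ZMod p)) := by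
    unfold zpFourier chiN gaussSum
    refine Finset.sum_nbij' (fun a : ℕ => (a : ZMod p)) ZMod.val (fun _ _ => Finset.mem_univ _)
      (fun a _ => Finset.mem_range.mpr (ZMod.val_lt a))
      (fun a ha => ZMod.val_natCast_of_lt (Finset.mem_range.mp ha))
      (fun a _ => ZMod.natCast_zmod_val a) (fun a _ => ?_)
    rw [cubicMulChar_apply, AddChar.mulShift_apply, hchar]
  rw [hsum]
  by_cases hk : (k : ZMod p) = 0
  · -- `k ≡ 0`: the additive character is trivial and `Σ χ = 0`
    have h0 : chiN p r k = 0 := by unfold chiN; rw [hk]; simp [cubicChar]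
    rw [h0, map_zero, zero_mul, hk, AddChar.mulShift_zero]
    simp only [gaussSum, AddChar.one_apply, mul_one]
    exact MulChar.sum_eq_zero_of_ne_one (cubicMulChar_ne_one h3 hr)
  · -- `k ≢ 0`: `gaussSum_mulShift_eq`
    rw [show (k : ZMod p) = ((Units.mk0 (k : ZMod p) hk : (ZMod p)ˣ) : ZMod p) from rfl,
      gaussSum_mulShift_eq, ← cubicGaussSum_eq_gaussSum h3 hr, Units.val_mk0, ← MulChar.star_apply',
      cubicMulChar_apply]
    rfl

/-! ### The main identity for the cubic character -/

variable {N L p r} in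
/-- **Main identity (cubic case).** For `p ≡ 1 (mod 3)` prime (so `p ≥ 7`), `r` a primitive root,
`L ≥ 1` and `N ≥ 8pL`: the inner product of the transformed repeated reference with the `χ(k_y)`-weighted
transform of the repeated character state is `G · goodWeight` up to `π N √L p`, where
`LN/2 ≤ goodWeight ≤ LN`; in particular its argument is that of the cubic Gauss sum `G` up to a
relative error `O(p^{3/2}/√L)`. [cite: VanDamSeroussi2002, §4 Algorithm 1 and Thm. 1 (the eigenphase `G/√p`)] -/
theorem cubic_main (hp : p.Prime) (h3 : p % 3 = 1) (hr : IsPrimitiveRoot (r : ZMod p) (p - 1))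
    (hL : 0 < L) (h8 : 8 * p * L ≤ N) :
    ‖(∑ y ∈ range N, (starRingEnd ℂ) (dirichletSum N L p y) * chiN p r (nearIdx N p y) *
          repFourier N L p (chiN p r) y) - cubicGaussSum p r * goodWeight N L p‖ ≤
        Real.pi * N * Real.sqrt L * p ∧
      (L : ℝ) * N / 2 ≤ goodWeight N L p ∧ goodWeight N L p ≤ L * N := by
  have hp7 : 7 ≤ p := by
    have h2 := hp.two_le
    by_contra h
    interval_cases p <;> first | omega | exact absurd hp (by norm_num)
  have hp0 : 0 < p := by omega
  have hN : 0 < N := lt_of_lt_of_le (by positivity) h8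
  have hLN : L * p ≤ N := by nlinarith
  refine ⟨?_, half_le_goodWeight hp7 hL h8, goodWeight_le hN hp0 hLN⟩
  -- the main term is `G · goodWeight`
  have hmain : ∑ y ∈ range N, (‖dirichletSum N L p y‖ ^ 2 : ℂ) * chiN p r (nearIdx N p y) *
      zpFourier p (chiN p r) (nearIdx N p y) = cubicGaussSum p r * goodWeight N L p := by
    rw [goodWeight, sum_filter, Complex.ofReal_sum, mul_sum]
    refine sum_congr rfl fun y _ => ?_
    rw [zpFourier_chiN p r hp h3 hr,
      show ∀ a b c d : ℂ, a * b * (c * d) = d * (a * (b * c)) from fun _ _ _ _ => by ring, chiN_mul_conj]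
    by_cases hd : p ∣ nearIdx N p y
    · simp [hd]
    · rw [if_neg hd, if_pos hd]; push_cast; ring
  have h := norm_inner_sub_main_le (N := N) (L := L) (p := p) hN hp0 hLN (chiN p r) norm_chiN_le (chiN p r)
  rw [hmain] at h
  refine h.trans ?_
  gcongr
  exact sum_norm_chiN_le

/-! ### Splitting along the cosets of cubes -/

variable {p r} in
/-- The values of `χ` off `0` are powers of `ω`: `Σ_{c<3} [χ(x) = ω^c]·ω^c = χ(x)`. [folklore] -/
theorem sum_omega_pow_ite_eq (x : ℕ) :
    ∑ c ∈ range 3, (if chiN p r x = omega ^ c then omega ^ c else 0) = chiN p r x := by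
  simp only [sum_range_succ, sum_range_zero, zero_add, pow_zero, pow_one]
  rcases chiN_cases (p := p) (r := r) x with h | h | h | h <;> rw [h]
  · rw [if_neg zero_ne_one, if_neg omega_ne_zero.symm, if_neg (pow_ne_zero 2 omega_ne_zero).symm]
    simp
  · rw [if_pos rfl, if_neg omega_ne_one.symm, if_neg omega_sq_ne_one.symm]; simp
  · rw [if_neg omega_ne_one, if_pos rfl, if_neg omega_ne_omega_sq]; simp
  · rw [if_neg omega_sq_ne_one, if_neg omega_ne_omega_sq.symm, if_pos rfl]; simp

variable {N L p r} in
/-- **The nine coset numbers recombine to the weighted inner product.** With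
`U c c' = Σ_{y<N, χ(k_y) = ω^c} conj(S y) · repFourier 𝟙_{χ = ω^{c'}} y`,
`Σ_{c<3} Σ_{c'<3} ω^{c+c'} U c c' = Σ_{y<N} conj(S y) χ(k_y) repFourier χ y`. [folklore] -/
theorem sum_omega_pow_coset_eq :
    ∑ c ∈ range 3, ∑ c' ∈ range 3, omega ^ (c + c') *
        ∑ y ∈ (range N).filter (fun y => chiN p r (nearIdx N p y) = omega ^ c),
          (starRingEnd ℂ) (dirichletSum N L p y) *
            repFourier N L p (fun x => if chiN p r x = omega ^ c' then 1 else 0) y =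
      ∑ y ∈ range N, (starRingEnd ℂ) (dirichletSum N L p y) * chiN p r (nearIdx N p y) *
        repFourier N L p (chiN p r) y := by
  set cS : ℕ → ℂ := fun y => (starRingEnd ℂ) (dirichletSum N L p y) with hcS
  -- linearity of `repFourier` in the coefficient vector
  have hlin : ∀ y, ∑ c' ∈ range 3, omega ^ c' *
      repFourier N L p (fun x => if chiN p r x = omega ^ c' then 1 else 0) y = repFourier N L p (chiN p r) y := by
    intro y
    unfold repFourier
    simp_rw [mul_sum]
    rw [sum_comm]; refine sum_congr rfl fun x _ => ?_
    rw [sum_comm]; refine sum_congr rfl fun j _ => ?_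
    calc ∑ c' ∈ range 3, omega ^ c' *
          ((if chiN p r x = omega ^ c' then 1 else 0) * eR (((x : ℝ) + j * p) * y / N))
        = (∑ c' ∈ range 3, if chiN p r x = omega ^ c' then omega ^ c' else 0) *
            eR (((x : ℝ) + j * p) * y / N) := by
          rw [sum_mul]; refine sum_congr rfl fun c' _ => ?_; split_ifs <;> ring
      _ = _ := by rw [sum_omega_pow_ite_eq]
  -- step 1: the `c'`-sum
  have step1 : ∀ c, (∑ c' ∈ range 3, omega ^ (c + c') *
      ∑ y ∈ (range N).filter (fun y => chiN p r (nearIdx N p y) = omega ^ c),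
        cS y * repFourier N L p (fun x => if chiN p r x = omega ^ c' then 1 else 0) y) =
      ∑ y ∈ (range N).filter (fun y => chiN p r (nearIdx N p y) = omega ^ c),
        omega ^ c * (cS y * repFourier N L p (chiN p r) y) := by
    intro c
    have hy : ∀ y, omega ^ c * (cS y * repFourier N L p (chiN p r) y) =
        ∑ c' ∈ range 3, omega ^ (c + c') *
          (cS y * repFourier N L p (fun x => if chiN p r x = omega ^ c' then 1 else 0) y) := by
      intro y
      rw [← hlin y, mul_sum, mul_sum]
      refine sum_congr rfl fun c' _ => ?_
      rw [pow_add]; ring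
    simp_rw [hy]
    rw [sum_comm]
    exact sum_congr rfl fun c' _ => by rw [mul_sum]
  -- step 2: the `c`-sum against the filter
  calc _ = ∑ c ∈ range 3, ∑ y ∈ (range N).filter (fun y => chiN p r (nearIdx N p y) = omega ^ c),
          omega ^ c * (cS y * repFourier N L p (chiN p r) y) := sum_congr rfl fun c _ => step1 c
    _ = ∑ c ∈ range 3, ∑ y ∈ range N, (if chiN p r (nearIdx N p y) = omega ^ c then omega ^ c else 0) *
          (cS y * repFourier N L p (chiN p r) y) := by
        refine sum_congr rfl fun c _ => ?_
        rw [sum_filter]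
        refine sum_congr rfl fun y _ => ?_
        split_ifs <;> simp
    _ = ∑ y ∈ range N, ∑ c ∈ range 3, (if chiN p r (nearIdx N p y) = omega ^ c then omega ^ c else 0) *
          (cS y * repFourier N L p (chiN p r) y) := sum_comm
    _ = _ := by
        refine sum_congr rfl fun y _ => ?_
        rw [← sum_mul, sum_omega_pow_ite_eq]; ring

end VanDamSeroussi

end Literature.Computability.Cryptography
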